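import Summits.QuantumFields.BalabanUV.Beta.EriceRemainderEnclosureHistoryAutonomyComparisonAgeCompositionStaticEnd

/-!
# EriceRemainderEnclosureHistoryAutonomyComparisonAgeCompositionStaticEndFlow — (E81i) ROUTE (N), FIRST ORDER, THE END FOR THE FLOW MODULO STATIC
# FAMILIES: along every box solution of an isotone memory with floor dominated by a profile, with the flow's lone kernels, persistence defects, chain and
# per-pin growth factors, the first-order comparison surplus is non-negative AS SOON AS (S-a) the damped row masses of the ages ≥ 2 do not increase with
# the pin, (S-b) the young kernels' tail sums dominate the next row's tail sums weighted by `(1 + M)·Hg`, and (S-c) the aggregates' tail sums dominate the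
# next row's weighted by `Hg` — the lag-zero masses are `< 1` by the window budget at the young scale `1`, the chain closes by (E80c)

Cell `pub-balaban`, β-function sub-cell, BINDER row D4 «RemainderConst leaves for Bałaban's split» (`HOME/BINDER-OWNERS.md`; owner lineage `b2b-balaban-beta-an4`;
this file by co-owner #2 lineage `b2b-balaban-beta-d4-p2`, generation 72), β-FLOW TEAM duty (1), FREEZE (0) honoured (def-free; imports (E81h) `…StaticEnd`;
uses (E75a) `load_budget_window_at_pin`∕`weight_nonneg`∕`weight_eq_zero_of_horizon`∕`defect_nonneg`∕`persistence`∕`defect_mono`, (E80e) `age_chain_closes`,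
(E81d) `flow_cum_dom_of_rowmass`∕`flow_rowmass_one`, (E81h) `nonneg_of_static_families` BY NAME; nothing restated).

HONEST FRAMING (page 1, verbatim and binding).  *"Discharging BetaPertH makes Bałaban's UV stability UNCONDITIONAL — a real constructive-QFT result; it is
NOT the continuum limit and NOT the Clay problem."*  THIS FILE DISCHARGES NOTHING OF THE KIND.  Elementary real analysis about ABSTRACT functionals on a box
]0,γ]^ℕ with displayed floors, profiles and signs, and the FIRST-ORDER renewal objects of route (N) built from them — hypotheses of a census, not facts; the
form, signs, ages and moments of Bałaban's (1.22) limit functional are NOT PRINTED ([I] p. 298; GAPS G-t4-U2-1∕-2) and NOT asserted.  Row D4 class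
UNCHANGED (critical-path width 0; instance 0∕1; D4 DISCHARGE NO DATE).  HONEST DEPENDENCY: continuum YM on T⁴ ⇐ BetaPertH ∧ nine spine estimates (0/9
proved); BetaPertH ⇐ (D1) ∧ (D4) ∧ CAP+tail; G-an2-4 gates asym, D1 and NE2/3/4.

THE POINT (census sense (α); route (N); README `g72/e81/README.md` §5).  §1 **`flow_lag_zero_mass_lt_one`**: `Σ_{k∈(i,K−1]} KL k m 0 ≤ Σ_{1≤k<K} L_kh_{m+k}³∕2
≤ 1∕√2 < 1` (the window budget (E65a)∕(E75a) at the scale `j = 1`: weights `√(k∕(k+1)) ≥ 1∕√2`).  §2 **`flow_nonneg_of_static_families`** = (E81h)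
`nonneg_of_static_families` ON THE FLOW: the lone kernels `KL`, defects `θ`, reads and solution operators of (E80e)∕(E80f), a chain `(ρ, β)` with the
recursion of (E80e) `exists_static_chain` (closing by (E80e) `age_chain_closes`), cumulative domination from (S-a) `hrow` (ages ≥ 2; the age 1 by (E81d)), and
the static families (S-b) `hSb`∕`hSbp`, (S-c) `hSc`∕`hScp` with the growth factors `Hg i m = (1 + Σ_{k∈(i,K−1]} θ k m 1·β (i+1) m k)∕(1 − Σ_{k∈(i,K−1]} KL k m 0)`.
COMPARED WITH (E80f) `flow_nonneg_of_mono2` (hypotheses MONOa ∧ MONO″ about solutions of triangular systems for every admissible input) and (E81d)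
`flow_nonneg_of_criteria` ((a) ∧ a read-decay inequality about old surpluses), EVERY hypothesis here is an explicit inequality between kernel entries `KL k m l`,
defects `θ`, the chain's ratios `β` and finite sums of them.  NUMERICS (`g72/numerics/m13`–`m18`): all three families hold along every flow tested
(self-consistent damping; (S-a) 0.970–0.9994, (S-b) ≤ 0.987 ∕ 0.88, growth factors attained, (M1) 0 violations).  NOT CLAIMED: (S-a), (S-b), (S-c) as
theorems about the flow — README §5: (S-a) is second-order thin for far old ages under a saturated young age (hybrid criterion (E81e) §2 there), (S-b)∕(S-c)
need quantitative bounds on `β` (export of (E80b)); anything nonlinear; anything printed.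

WHAT IS PROVED ([folklore]; 0 `def`, 0 sorry).  §1 `sqrt_half_le_weight`, **`flow_lag_zero_mass_lt_one`**.  §2 **`flow_nonneg_of_static_families`**.
-/
noncomputable section
open Finset

namespace Summit.QuantumFields.BalabanUV.Beta.EriceRemainderEnclosureHistoryAutonomyComparisonAgeCompositionStaticEndFlow

open Literature.MathematicalPhysics.QuantumFieldTheory.Balaban1983to89
open Literature.MathematicalPhysics.QuantumFieldTheory.Balaban1983to89.T4BetaStationary
open Literature.MathematicalPhysics.QuantumFieldTheory.Balaban1983to89.T4BetaFlowWellPosed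
open Summit.QuantumFields.BalabanUV.Beta.EriceRemainderEnclosureHistoryAutonomyOrder (strictAnti_of_memFlow)
open Summit.QuantumFields.BalabanUV.Beta.EriceRemainderEnclosureHistoryAutonomyComparisonAgeCompositionIdentification
open Summit.QuantumFields.BalabanUV.Beta.EriceRemainderEnclosureHistoryAutonomyComparisonAgeCompositionChainWiringAtPin
open Summit.QuantumFields.BalabanUV.Beta.EriceRemainderEnclosureHistoryAutonomyComparisonAgeCompositionCriteriaFlow
open Summit.QuantumFields.BalabanUV.Beta.EriceRemainderEnclosureHistoryAutonomyComparisonAgeCompositionStaticEnd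

variable {B : (ℕ → ℝ) → ℝ} {γ b gIR : ℝ} {L : ℕ → ℝ} {K : ℕ} {h g : ℕ → ℝ} {KL : ℕ → ℕ → ℕ → ℝ}

/-! ## §1 The lag-zero masses are below one (window budget at the scale one) -/

/-- `√(1∕2) ≤ √(k∕(k+0+1))` for `1 ≤ k`. [folklore] -/
theorem sqrt_half_le_weight {k : ℕ} (hk : 1 ≤ k) : Real.sqrt (1 / 2) ≤ Real.sqrt ((k : ℝ) / ((k : ℝ) + (0:ℕ) + 1)) := by
  apply Real.sqrt_le_sqrt
  have hk' : (1 : ℝ) ≤ k := by exact_mod_cast hk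
  rw [Nat.cast_zero, add_zero, div_le_div_iff₀ (by norm_num) (by positivity)]
  linarith

/-- **THE LAG-ZERO MASSES ARE `< 1`**: `Σ_{k∈(i,K−1]} KL k m 0 ≤ Σ_{1≤k<K} L_kh_{m+k}³∕2 ≤ 1∕√2` along every box solution (budget at the scale `1`).
[folklore] -/
theorem flow_lag_zero_mass_lt_one (hmono : ∀ u v : ℕ → ℝ, SeqBox γ u → SeqBox γ v → (∀ j, u j ≤ v j) → B u ≤ B v) (hL : ∀ k, 0 ≤ L k)
    (hb : 0 < b) (hlo : ∀ u, SeqBox γ u → b ≤ B u) (hdom : ∀ u, SeqBox γ u → ∑ k ∈ range K, L k * u k ≤ B u)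
    (hh : SeqBox γ h) (hf : MemFlow B gIR h) (hg : ∀ t, 0 < g t ∧ g t ≤ 1)
    (hKL : ∀ k n l, KL k n l = if 0 < k ∧ k < K ∧ l < k then L k * h (n + k) ^ 3 / 2 * ∏ t ∈ Ico (n + 1 + l) (n + k + 1), g t else 0)
    (i m : ℕ) : ∑ k ∈ Ioc i (K - 1), KL k m 0 < 1 := by
  have hpos : ∀ n, 0 < h n := fun n => (hh n).1
  have hbud := load_budget_window_at_pin hmono hL hb hlo hdom hh hf m (j := 1) le_rfl
  -- each term of the budget at j = 1 is L_k h_{m+k}³ √(k/(k+1)) ≥ L_k h_{m+k}³ √(1/2)   (k ≥ 1), and 0 for k = 0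
  have hterm : ∀ k ∈ range K, (if 1 ≤ k then L k * h (m + k) ^ 3 * Real.sqrt (1 / 2) else 0) ≤
      L k * k * h (m + k) ^ 3 * (if k ≤ 1 then (∑ l ∈ range 1, Real.sqrt ((k : ℝ) / ((k : ℝ) + l + 1))) / ((1:ℕ):ℝ)
        else (∑ l ∈ range 1, Real.sqrt ((k : ℝ) / ((k : ℝ) + l + 1))) / k) := by
    intro k _
    have hk3 : 0 ≤ L k * h (m + k) ^ 3 := by have := hL k; have := hpos (m + k); positivity
    rcases Nat.lt_or_ge k 1 with hk | hk
    · have : k = 0 := by omega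
      subst this; simp
    · rw [if_pos hk, sum_range_one]
      have hw := sqrt_half_le_weight hk
      rcases eq_or_lt_of_le hk with h1 | h1
      · subst h1
        rw [if_pos le_rfl]
        have e : L 1 * ((1:ℕ):ℝ) * h (m + 1) ^ 3 * (Real.sqrt (((1:ℕ) : ℝ) / (((1:ℕ) : ℝ) + ((0:ℕ):ℝ) + 1)) / ((1:ℕ):ℝ)) =
            L 1 * h (m + 1) ^ 3 * Real.sqrt (((1:ℕ) : ℝ) / (((1:ℕ) : ℝ) + ((0:ℕ):ℝ) + 1)) := by
          simp only [Nat.cast_one, mul_one, div_one]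
        rw [e]
        exact mul_le_mul_of_nonneg_left hw hk3
      · rw [if_neg (by omega)]
        have hkpos : (0:ℝ) < k := by exact_mod_cast (by omega : 0 < k)
        rw [show L k * (k : ℝ) * h (m + k) ^ 3 * (Real.sqrt ((k : ℝ) / ((k : ℝ) + ((0 : ℕ):ℝ) + 1)) / k) =
          L k * h (m + k) ^ 3 * Real.sqrt ((k : ℝ) / ((k : ℝ) + ((0 : ℕ):ℝ) + 1)) by field_simp]
        exact mul_le_mul_of_nonneg_left hw hk3
  have hsum := (sum_le_sum hterm).trans hbud
  -- Σ_{Ioc i (K−1)} KL k m 0 ≤ Σ_{k<K, k≥1} L_k h³/2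
  have hKLle : ∑ k ∈ Ioc i (K - 1), KL k m 0 ≤ ∑ k ∈ range K, (if 1 ≤ k then L k * h (m + k) ^ 3 / 2 else 0) := by
    have hsub : Ioc i (K - 1) ⊆ range K ∨ K = 0 := by
      rcases Nat.eq_zero_or_pos K with h0 | h0
      · exact Or.inr h0
      · exact Or.inl fun k hk => by have := mem_Ioc.mp hk; exact mem_range.mpr (by omega)
    rcases hsub with hsub | hK0
    · refine (sum_le_sum_of_subset_of_nonneg hsub fun k _ _ => weight_nonneg hL hpos hg hKL k m 0).trans (sum_le_sum fun k hk => ?_)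
      rw [hKL]
      split_ifs with h1 h2 h2
      · rw [show m + 1 + 0 = m + 1 by ring]
        have hP := prod_damping_le_one hg (Ico (m + 1) (m + k + 1))
        have hc : 0 ≤ L k * h (m + k) ^ 3 / 2 := by have := hL k; have := hpos (m + k); positivity
        nlinarith
      · exact absurd h1.1 (by omega)
      · have := hL k; have := hpos (m + k); positivity
      · exact le_rfl
    · subst hK0
      simp
  have hhalf : ∑ k ∈ range K, (if 1 ≤ k then L k * h (m + k) ^ 3 / 2 else 0) =
      (∑ k ∈ range K, (if 1 ≤ k then L k * h (m + k) ^ 3 * Real.sqrt (1 / 2) else 0)) / (2 * Real.sqrt (1 / 2)) := by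
    rw [sum_div]
    refine sum_congr rfl fun k _ => ?_
    split_ifs
    · have hs : 0 < Real.sqrt (1 / 2) := Real.sqrt_pos.mpr (by norm_num)
      field_simp
    · simp
  have hs2 : Real.sqrt (1 / 2) * Real.sqrt (1 / 2) = 1 / 2 := Real.mul_self_sqrt (by norm_num)
  have hs0 : 0 < Real.sqrt (1 / 2) := Real.sqrt_pos.mpr (by norm_num)
  -- 1/(2√(1/2)) = √(1/2) < 1
  have hslt : Real.sqrt (1 / 2) < 1 := by nlinarith
  calc ∑ k ∈ Ioc i (K - 1), KL k m 0 ≤ (∑ k ∈ range K, (if 1 ≤ k then L k * h (m + k) ^ 3 * Real.sqrt (1 / 2) else 0)) / (2 * Real.sqrt (1 / 2)) :=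
        hKLle.trans (le_of_eq hhalf)
    _ ≤ 1 / (2 * Real.sqrt (1 / 2)) := div_le_div_of_nonneg_right hsum (by positivity)
    _ = Real.sqrt (1 / 2) := by field_simp; linarith [hs2]
    _ < 1 := hslt

/-! ## §2 The END for the flow modulo the static families -/

/-- **ROUTE (N), FIRST ORDER, END FOR THE FLOW — MODULO (S-a), (S-b), (S-c).**  As (E80f) `flow_nonneg_of_mono2` ∕ (E81d) `flow_nonneg_of_criteria`, with
every monotonicity hypothesis replaced by the static families of (E81h) `nonneg_of_static_families`, for a chain `(ρ, β)` with (E80e)'s recursion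
(it exists, `exists_static_chain`, and closes, `age_chain_closes`) and the growth factors `Hg` built from it. [folklore] -/
theorem flow_nonneg_of_static_families (hmono : ∀ u v : ℕ → ℝ, SeqBox γ u → SeqBox γ v → (∀ j, u j ≤ v j) → B u ≤ B v)
    (hL : ∀ k, 0 ≤ L k) (hb : 0 < b) (hlo : ∀ u, SeqBox γ u → b ≤ B u) (hdom : ∀ u, SeqBox γ u → ∑ k ∈ range K, L k * u k ≤ B u)
    (hh : SeqBox γ h) (hf : MemFlow B gIR h)
    (hg : ∀ t, 0 < g t ∧ g t ≤ 1) (hgF : ∀ t, 1 / (1 + ∑ k ∈ range K, L k * h (t + k) ^ 3 / 2) ≤ g t) (hK : 2 ≤ K)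
    (hKL : ∀ k n l, KL k n l = if 0 < k ∧ k < K ∧ l < k then L k * h (n + k) ^ 3 / 2 * ∏ t ∈ Ico (n + 1 + l) (n + k + 1), g t else 0)
    {θ : ℕ → ℕ → ℕ → ℝ} (hθ : ∀ k n l, θ k n l = 1 - (h (n + k + l) / h (n + k)) ^ 3 * ∏ t ∈ Ico (n + k + 1) (n + k + l + 1), g t)
    {KA : ℕ → ℕ → ℕ → ℝ} {RL RA SL SA : ℕ → (ℕ → ℝ) → ℕ → ℝ}
    (hRL : ∀ i v m, RL i v m = ∑ l ∈ range K, KL i m l * v (m + 1 + l))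
    (hRA : ∀ i v m, RA i v m = ∑ l ∈ range K, KA i m l * v (m + 1 + l))
    (hKA : ∀ i m l, KA i m l = KL i m l + KA (i + 1) m l) (hKAtop : ∀ m l, KA K m l = 0)
    (hSL : ∀ i (w : ℕ → ℝ), (∀ m, K < m → w m = 0) → (∀ m, K < m → SL i w m = 0) ∧ ∀ m, SL i w m = w m - RL i (SL i w) m)
    (hSA : ∀ i (w : ℕ → ℝ), (∀ m, K < m → w m = 0) → (∀ m, K < m → SA i w m = 0) ∧ ∀ m, SA i w m = w m - RA i (SA i w) m)
    {ρ : ℕ → ℕ → ℝ} {β : ℕ → ℕ → ℕ → ℝ}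
    (hρ : ∀ i n, 1 ≤ i → i ≤ K - 1 → ρ i n = (∑ l ∈ range K, KL i n l) * (1 + ∑ k ∈ Ioc i (K - 1), θ k n i * β (i + 1) n k) /
      (1 - ∑ k ∈ Ioc i (K - 1), ∑ l ∈ range i, KL k n l))
    (hβnew : ∀ i n, 1 ≤ i → i ≤ K - 1 → β i n i = ρ i n / (1 - ρ i n))
    (hβold : ∀ i n k, 1 ≤ i → i < k → k ≤ K - 1 → β i n k = β (i + 1) n k / (1 - ρ i n))
    (hrow : ∀ k n, 2 ≤ k → k < K → ∑ l ∈ range k, KL k (n + 1) l ≤ ∑ l ∈ range k, KL k n l)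
    {Hg : ℕ → ℕ → ℝ} (hH : ∀ i m, Hg i m = (1 + ∑ k ∈ Ioc i (K - 1), θ k m 1 * β (i + 1) m k) / (1 - ∑ k ∈ Ioc i (K - 1), KL k m 0))
    {M : ℕ → ℕ → ℝ} (hM : ∀ i m, M i m = KL i m 0 + ∑ l ∈ range (K - 1), max (KL i m (l + 1) - KL i (m + 1) l) 0)
    (hSb : ∀ i m, 1 ≤ i → i ≤ K - 1 → ∀ L', L' < i →
      (1 + M i m) * ∑ l ∈ Ico L' i, Hg i (m + 1 + l) * KL i (m + 1) l ≤ ∑ l ∈ Ico L' i, KL i m l)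
    (hSbp : ∀ i m, 1 ≤ i → i ≤ K - 1 → ∀ L₀, L₀ < i → ∀ L', L' ≤ L₀ →
      (1 + M i m) * ∑ l ∈ Ico L' L₀, Hg i (m + 1 + l) * KL i (m + 1) l ≤ ∑ l ∈ Ico L' (L₀ + 1), KL i m l)
    (hSc : ∀ i m, 1 ≤ i → i ≤ K - 1 → ∀ L', L' < K → ∑ l ∈ Ico L' K, Hg (i - 1) (m + 1 + l) * KA i (m + 1) l ≤ ∑ l ∈ Ico L' K, KA i m l)
    (hScp : ∀ i m, 1 ≤ i → i ≤ K - 1 → ∀ L₀, L₀ < K → ∀ L', L' ≤ L₀ →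
      ∑ l ∈ Ico L' L₀, Hg (i - 1) (m + 1 + l) * KA i (m + 1) l ≤ ∑ l ∈ Ico L' (L₀ + 1), KA i m l)
    {e ε : ℕ → ℝ} (he0 : ∀ m, 0 ≤ e m) (hea : ∀ m, e (m + 1) ≤ e m) (het : ∀ m, K < m → e m = 0)
    (hεt : ∀ m, K < m → ε m = 0) (hεrec : ∀ m, ε m = e m - RA 1 ε m) : ∀ m, 0 ≤ ε m := by
  have hh0 : ∀ n, 0 < h n := fun n => (hh n).1
  have hanti := (strictAnti_of_memFlow hb hlo hh hf).antitone
  have hac := fun n i (hi1 : 1 ≤ i) (hiK : i ≤ K - 1) =>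
    age_chain_closes hmono hL hb hlo hdom hh hf hg hgF hKL hθ hρ hβnew hβold n hi1 hiK
  have hcumL : ∀ k, 1 ≤ k → k ≤ K - 1 → ∀ m M', ∑ l ∈ range (M' + 1), KL k (m + 1) l ≤ ∑ l ∈ range (M' + 2), KL k m l := by
    intro k hk1 hkK m M'
    refine flow_cum_dom_of_rowmass hL hh0 hanti hg hKL (fun n => ?_) m M'
    rcases Nat.lt_or_ge k 2 with hk2 | hk2
    · have : k = 1 := by omega
      subst this
      exact flow_rowmass_one hmono hL hb hlo hdom hh hf hg hgF hK hKL n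
    · exact hrow k n hk2 (by omega)
  exact nonneg_of_static_families (N := K) (n := K - 1) (y := fun i => i) (KL := KL) (θ := θ)
    (weight_nonneg hL hh0 hg hKL) (weight_eq_zero_of_horizon hKL)
    (fun i m l hl => by rw [hKL, if_neg (fun h3 => by omega)])
    hRL hRA hKA (fun m l => by rw [Nat.sub_add_cancel (by omega : 1 ≤ K)]; exact hKAtop m l) hSL hSA
    (fun i hi1 hiK => ⟨hi1, by omega⟩)
    (defect_nonneg hh0 hanti hg hθ) (persistence hL hh0 hg hKL hθ) (fun k m l l' hll' => defect_mono hh0 hanti hg hθ k m hll')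
    hρ hβnew hβold (fun i m hi1 hiK => (hac m i hi1 hiK).2) (fun i m hi1 hiK => (hac m i hi1 hiK).1) hcumL
    (fun i m _ => flow_lag_zero_mass_lt_one hmono hL hb hlo hdom hh hf hg hKL i m) hH hM hSb hSbp hSc hScp he0 hea het hεt hεrec

end Summit.QuantumFields.BalabanUV.Beta.EriceRemainderEnclosureHistoryAutonomyComparisonAgeCompositionStaticEndFlow

end
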